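import Summits.QuantumFields.YangMills.Theorems.SwapTwistDeficitToronLog
import HarnessLib

/-!
# The THREE-LETTER nearly-commuting floor: `Haar³{C : SU(2)³ | ∀ μ ν, ‖q(C_μ)q(C_ν) − q(C_ν)q(C_μ)‖ ≤ t} ≥ c·t⁴` — NO logarithm
# (free-hands support of item stmt-QuantumFields-24197 `SwapVirialDeficit.SwapGluedStiffness`; brick (α1) of LEAD ym-line-sfw-p2 g93's 05:57Z ruling ∕
# the swap-central cone of seat w2 g54's stratum census SWAP-STRATA (evidence #2 on ⟨stmt-QuantumFields-23802⟩), line «(C): cone of commuting TRIPLES,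
# dim 5, 4 transverse masses ⇒ exponent (9N−2)/2, no log»)

For three Haar-random letters of `SU(2)` the event that their unit quaternions pairwise commute up to `t` has product-Haar mass `≍ t⁴` WITHOUT a
logarithm (against `t⁶·log t⁻¹` for four letters, ✓`ToronLog.haar_pi_nearlyCommuting_ge`): with `m = ‖Im q(C₀)‖` the largest imaginary part, the
other two letters live in solid cylinders of radius `≍ t/m` about the axis of `C₀`, mass `≍ (t²/m)²·m²dm` — integrable at `m → 0`, so ONE shell
`m ≍ 1/16` already carries the full order `t⁴`.  This file proves the floor by truncating the dyadic shell sum of ✓`SwapTwistDeficitToronLog` at its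
first term:

* §1 `three_subset` — `x 0` in the axis box at height `ρ`, `x 1, x 2` in the thin box of width `δ` rotated onto `Im x 0` ⟹ all three in the unit
  ball of `ℍ` and pairwise `‖q q′ − q′ q‖ ≤ 24ρδ` for the normalised letters (✓`ToronLog.shellSet_subset` applied to the quadruple `(x 0, x 1, x 2, x 1)`);
* §2 `measurableSet_threeProd`, `pi_coneMeasure_threeShell` — the product-cone mass of that event is EXACTLY `coneConst³·(ρ³/32)·(ρδ²)²`
  (Fubini over `x 0`; each rotated thin box has Lebesgue volume `ρδ²`, ✓`ToronLog.volume_fiber`);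
* §3 `measurableSet_nearlyCommuting_three`, ★ `haar_pi_nearlyCommuting_three_ge` — with `ρ = 1/16`, `δ = 2t/3` (`24ρδ = t`), for `0 < t ≤ 3/32`:
  `c·t⁴ ≤ Haar³{…}` with `c = coneConst³/169869312 = (2/π²)³·16⁻⁵·(2/3)⁴/32`.

Consumers (cell ym-idea-1, 2026-08-31): the log-free fixed-`L` FLOOR of the σ-glued (swap-twisted) femto ring `c_L·e^{12βL⁴}·β^{−(9L⁴−1)} ≤ TT.twistTrace L β (2L)`
(w3 g61's (α2-v), parametric in this bound and in the σ-twisted four-letter floor `≍ t⁷` = this `t⁴` × a `t³` ball for the slaved letter), and LEAD g93's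
matching three-letter CEILING `≤ C·t⁴`.
HONEST LABEL: a finite-dimensional Haar-volume lemma toward a fixed-`L` prediction row (`Z^S ≍ e^{12βL⁴}β^{−(9L⁴−1)}`, no log on the swap side); ⟨24197⟩,
⟨24194⟩, ⟨24497⟩, ⟨24196⟩ stay OPEN; nothing about any crux or rung is proved; the Yang–Mills mass gap is NOT proved; no summit is proved by a line.
THEOREMS ONLY (0 `def`, 0 `sorry`), standard axioms.  Width seat ym-line-sfw-p2-w2 g54 (cell ym-idea-1, free hands), `--supports stmt-QuantumFields-24197`.
References: [cite: Luscher1983, §2]; [cite: Vanbaal2001]; [cite: GonzalezarroyoAltes1988]; [folklore].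
-/

set_option autoImplicit false

noncomputable section

open MeasureTheory Quaternion Set
open scoped Quaternion ENNReal BigOperators
open Literature.MathematicalPhysics.QuantumLattice
open Literature.MathematicalPhysics.QuantumFieldTheory (haarProbability)
open Summit.QuantumFields.YangMills.Theorems.SwapTwistDeficit.ToronLog

attribute [local instance] Literature.Analysis.FluidPDE.Tao2016.quatMeasurableSpace
  Literature.Analysis.FluidPDE.Tao2016.quatBorelSpace
  Literature.MathematicalPhysics.QuantumLattice.secondCountableTopology_su2

namespace Summit.QuantumFields.YangMills.Theorems.SwapVirialDeficit.NearlyCommutingThreeFloor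

/-! ## §1 Three letters in one shell pairwise almost commute -/

/-- **Three letters in one shell**: `x 0` in the axis box at height `ρ`, `x 1, x 2` in the thin box of width `δ` rotated onto the imaginary axis of
`x 0` ⟹ every letter lies in the unit ball of `ℍ` and the normalised letters pairwise almost commute, `‖q(x_μ)q(x_ν) − q(x_ν)q(x_μ)‖ ≤ 24ρδ`
(the four-letter lemma ✓`ToronLog.shellSet_subset` applied to the quadruple `(x 0, x 1, x 2, x 1)`). [folklore] -/
theorem three_subset {ρ δ : ℝ} (hρ0 : 0 < ρ) (hρ : ρ ≤ 1 / 16) (hδ : 0 ≤ δ) (hδρ : δ ≤ ρ) {x : Fin 3 → ℍ}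
    (h0 : x 0 ∈ quatBox (axisLo ρ) (axisHi ρ)) (hj : ∀ j : Fin 2, x j.succ ∈ fiber (thinLo ρ δ) (thinHi ρ δ) (x 0)) :
    (∀ μ, x μ ∈ Metric.ball (0 : ℍ) 1) ∧
      ∀ μ ν, ‖su2Quat (quatToSU2 (x μ)) * su2Quat (quatToSU2 (x ν)) -
        su2Quat (quatToSU2 (x ν)) * su2Quat (quatToSU2 (x μ))‖ ≤ 24 * ρ * δ := by
  -- the quadruple `(x 0, x 1, x 2, x 1)` lies in the four-letter shell event
  have hyS : (![x 0, x 1, x 2, x 1] : Fin 4 → ℍ) ∈ shellSet ρ δ := by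
    refine ⟨h0, fun j => ?_⟩
    fin_cases j
    · exact hj 0
    · exact hj 1
    · exact hj 0
  have h := shellSet_subset hρ0 hρ hδ hδρ hyS
  have e : ∀ μ : Fin 3, x μ = (![x 0, x 1, x 2, x 1] : Fin 4 → ℍ) (Fin.castSucc μ) := by
    intro μ; fin_cases μ <;> rfl
  refine ⟨fun μ => ?_, fun μ ν => ?_⟩
  · rw [e μ]; exact h.1 _
  · rw [e μ, e ν]; exact h.2 _ _

/-! ## §2 The product-cone mass of the three-letter shell event -/

/-- The three-letter shell event in product form `(x 0, (x 1, x 2))` is measurable. [folklore] -/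
theorem measurableSet_threeProd (ρ δ : ℝ) :
    MeasurableSet {p : ℍ × (Fin 2 → ℍ) | p.1 ∈ quatBox (axisLo ρ) (axisHi ρ) ∧ ∀ j : Fin 2, p.2 j ∈ fiber (thinLo ρ δ) (thinHi ρ δ) p.1} := by
  have h1 : MeasurableSet ((fun p : ℍ × (Fin 2 → ℍ) => p.1) ⁻¹' quatBox (axisLo ρ) (axisHi ρ)) :=
    measurable_fst (measurableSet_quatBox _ _)
  have h2 : ∀ j : Fin 2, MeasurableSet
      ((fun p : ℍ × (Fin 2 → ℍ) => (normSq (coneQ p.1))⁻¹ • (coneQstar p.1 * p.2 j * coneQ p.1)) ⁻¹'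
        quatBox (thinLo ρ δ) (thinHi ρ δ)) := by
    intro j
    have hf : Measurable fun p : ℍ × (Fin 2 → ℍ) => (normSq (coneQ p.1))⁻¹ :=
      ((continuous_normSq.comp (continuous_coneQ.comp continuous_fst)).measurable).inv
    have hg : Measurable fun p : ℍ × (Fin 2 → ℍ) => coneQstar p.1 * p.2 j * coneQ p.1 :=
      (((continuous_coneQstar.comp continuous_fst).mul ((continuous_apply j).comp continuous_snd)).mul
        (continuous_coneQ.comp continuous_fst)).measurable
    exact (hf.smul hg) (measurableSet_quatBox _ _)
  have e : {p : ℍ × (Fin 2 → ℍ) | p.1 ∈ quatBox (axisLo ρ) (axisHi ρ) ∧ ∀ j : Fin 2, p.2 j ∈ fiber (thinLo ρ δ) (thinHi ρ δ) p.1} =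
      ((fun p : ℍ × (Fin 2 → ℍ) => p.1) ⁻¹' quatBox (axisLo ρ) (axisHi ρ)) ∩
      ⋂ j : Fin 2, ((fun p : ℍ × (Fin 2 → ℍ) => (normSq (coneQ p.1))⁻¹ • (coneQstar p.1 * p.2 j * coneQ p.1)) ⁻¹'
        quatBox (thinLo ρ δ) (thinHi ρ δ)) := by
    ext p
    simp only [fiber, Set.mem_setOf_eq, Set.mem_inter_iff, Set.mem_iInter, Set.mem_preimage]
  rw [e]
  exact h1.inter (MeasurableSet.iInter h2)

/-- The three-letter shell event is measurable. [folklore] -/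
theorem measurableSet_threeShell (ρ δ : ℝ) :
    MeasurableSet {x : Fin 3 → ℍ | x 0 ∈ quatBox (axisLo ρ) (axisHi ρ) ∧ ∀ j : Fin 2, x j.succ ∈ fiber (thinLo ρ δ) (thinHi ρ δ) (x 0)} := by
  have e : {x : Fin 3 → ℍ | x 0 ∈ quatBox (axisLo ρ) (axisHi ρ) ∧ ∀ j : Fin 2, x j.succ ∈ fiber (thinLo ρ δ) (thinHi ρ δ) (x 0)} =
      (MeasurableEquiv.piFinSuccAbove (fun _ : Fin 3 => ℍ) 0) ⁻¹'
        {p : ℍ × (Fin 2 → ℍ) | p.1 ∈ quatBox (axisLo ρ) (axisHi ρ) ∧ ∀ j : Fin 2, p.2 j ∈ fiber (thinLo ρ δ) (thinHi ρ δ) p.1} := by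
    ext x; exact Iff.rfl
  rw [e]
  exact (measurableSet_threeProd ρ δ).preimage (MeasurableEquiv.measurable _)

/-- **Mass of the three-letter shell event** under the product cone measure: `coneConst³ · (ρ³/32) · (ρδ²)²` EXACTLY — Fubini over `x 0`, the fibre
over each `x 0` of the axis box being a product of two rotated thin boxes of Lebesgue volume `ρδ²` each. [folklore] -/
theorem pi_coneMeasure_threeShell {ρ δ : ℝ} (hρ0 : 0 < ρ) (hρ : ρ ≤ 1 / 16) (hδ : 0 ≤ δ) (hδρ : δ ≤ ρ) :
    (Measure.pi fun _ : Fin 3 => coneMeasure)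
        {x : Fin 3 → ℍ | x 0 ∈ quatBox (axisLo ρ) (axisHi ρ) ∧ ∀ j : Fin 2, x j.succ ∈ fiber (thinLo ρ δ) (thinHi ρ δ) (x 0)} =
      ENNReal.ofReal (coneConst ^ 3 * (ρ ^ 5 * δ ^ 4 / 32)) := by
  haveI := isProbabilityMeasure_coneMeasure
  set P : Set (ℍ × (Fin 2 → ℍ)) :=
    {p | p.1 ∈ quatBox (axisLo ρ) (axisHi ρ) ∧ ∀ j : Fin 2, p.2 j ∈ fiber (thinLo ρ δ) (thinHi ρ δ) p.1} with hP
  have hS : MeasurableSet P := measurableSet_threeProd ρ δ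
  have e : {x : Fin 3 → ℍ | x 0 ∈ quatBox (axisLo ρ) (axisHi ρ) ∧ ∀ j : Fin 2, x j.succ ∈ fiber (thinLo ρ δ) (thinHi ρ δ) (x 0)} =
      (MeasurableEquiv.piFinSuccAbove (fun _ : Fin 3 => ℍ) 0) ⁻¹' P := by
    ext x; exact Iff.rfl
  rw [e, (measurePreserving_piFinSuccAbove (fun _ : Fin 3 => coneMeasure) 0).measure_preimage hS.nullMeasurableSet,
    Measure.prod_apply hS]
  -- the sections
  have hsec : ∀ y₀ : ℍ, (Measure.pi fun _ : Fin 2 => coneMeasure) (Prod.mk y₀ ⁻¹' P) =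
      (quatBox (axisLo ρ) (axisHi ρ)).indicator (fun y₀ => coneMeasure (fiber (thinLo ρ δ) (thinHi ρ δ) y₀) ^ 2) y₀ := by
    intro y₀
    by_cases hy : y₀ ∈ quatBox (axisLo ρ) (axisHi ρ)
    · rw [Set.indicator_of_mem hy]
      have e : Prod.mk y₀ ⁻¹' P = Set.pi Set.univ fun _ : Fin 2 => fiber (thinLo ρ δ) (thinHi ρ δ) y₀ := by
        ext f
        simp [hP, hy]
      rw [e, Measure.pi_pi, Finset.prod_const, Finset.card_univ, Fintype.card_fin]
    · rw [Set.indicator_of_notMem hy]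
      have e : Prod.mk y₀ ⁻¹' P = ∅ := by
        ext f
        simp [hP, hy]
      rw [e, measure_empty]
  simp_rw [hsec]
  rw [lintegral_indicator (measurableSet_quatBox _ _)]
  -- on the axis box the fibre mass is constant
  have hthin : volume (quatBox (thinLo ρ δ) (thinHi ρ δ)) = ENNReal.ofReal (ρ * δ ^ 2) := by
    rw [volume_quatBox]
    · congr 1
      simp only [thinLo, thinHi, Matrix.cons_val_zero, Matrix.cons_val_one, Matrix.cons_val]
      ring
    · intro i
      fin_cases i <;> simp [thinLo, thinHi] <;> linarith
  have haxis : volume (quatBox (axisLo ρ) (axisHi ρ)) = ENNReal.ofReal (ρ ^ 3 / 32) := by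
    rw [volume_quatBox]
    · congr 1
      simp only [axisLo, axisHi, Matrix.cons_val_zero, Matrix.cons_val_one, Matrix.cons_val]
      ring
    · intro i
      fin_cases i <;> simp [axisLo, axisHi] <;> linarith
  have hK : ∀ y₀ ∈ quatBox (axisLo ρ) (axisHi ρ),
      coneMeasure (fiber (thinLo ρ δ) (thinHi ρ δ) y₀) ^ 2 = (ENNReal.ofReal coneConst * ENNReal.ofReal (ρ * δ ^ 2)) ^ 2 := by
    intro y₀ hy
    have hyI : 0 < y₀.imI := (norm_lt_one_of_mem_axis hρ0 hρ hy).2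
    rw [coneMeasure_apply (measurableSet_fiber _ _ _) (fiber_subset_ball hρ hδ hδρ hyI), volume_fiber hyI, hthin,
      inv_volume_ball_eq]
  rw [setLIntegral_congr_fun (measurableSet_quatBox _ _) hK, setLIntegral_const,
    coneMeasure_apply (measurableSet_quatBox _ _) (axis_subset_ball hρ0 hρ), haxis, inv_volume_ball_eq]
  have hc : 0 ≤ coneConst := coneConst_pos.le
  rw [← ENNReal.ofReal_mul hc, ← ENNReal.ofReal_mul hc, ← ENNReal.ofReal_pow (by positivity), ← ENNReal.ofReal_mul (by positivity)]
  congr 1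
  ring

/-! ## §3 The three-letter floor -/

/-- The three-letter nearly-commuting event is measurable. [folklore] -/
theorem measurableSet_nearlyCommuting_three (t : ℝ) :
    MeasurableSet {C : Fin 3 → (Matrix.specialUnitaryGroup (Fin 2) ℂ) |
      ∀ μ ν : Fin 3, ‖su2Quat (C μ) * su2Quat (C ν) - su2Quat (C ν) * su2Quat (C μ)‖ ≤ t} := by
  have hq : ∀ μ : Fin 3, Measurable fun C : Fin 3 → (Matrix.specialUnitaryGroup (Fin 2) ℂ) => su2Quat (C μ) := fun μ =>
    Literature.MathematicalPhysics.QuantumFieldTheory.Balaban1983to89.T4HaarSU2Translate.measurable_su2Quat.comp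
      (measurable_pi_apply μ)
  have h : ∀ μ ν : Fin 3, MeasurableSet
      {C : Fin 3 → (Matrix.specialUnitaryGroup (Fin 2) ℂ) | ‖su2Quat (C μ) * su2Quat (C ν) - su2Quat (C ν) * su2Quat (C μ)‖ ≤ t} := fun μ ν =>
    measurableSet_le (((hq μ).mul (hq ν)).sub ((hq ν).mul (hq μ))).norm measurable_const
  have e : {C : Fin 3 → (Matrix.specialUnitaryGroup (Fin 2) ℂ) |
      ∀ μ ν : Fin 3, ‖su2Quat (C μ) * su2Quat (C ν) - su2Quat (C ν) * su2Quat (C μ)‖ ≤ t} = ⋂ μ : Fin 3, ⋂ ν : Fin 3,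
      {C : Fin 3 → (Matrix.specialUnitaryGroup (Fin 2) ℂ) | ‖su2Quat (C μ) * su2Quat (C ν) - su2Quat (C ν) * su2Quat (C μ)‖ ≤ t} := by
    ext C
    simp
  rw [e]
  exact MeasurableSet.iInter fun μ => MeasurableSet.iInter fun ν => h μ ν

/-- Letter-wise radial projection `ℍ³ → SU(2)³` maps the product cone measure to product Haar measure. [folklore] -/
theorem measurePreserving_proj_three :
    MeasurePreserving (fun (x : Fin 3 → ℍ) (μ : Fin 3) => quatToSU2 (x μ)) (Measure.pi fun _ : Fin 3 => coneMeasure)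
      (Measure.pi fun _ : Fin 3 => haarProbability (Matrix.specialUnitaryGroup (Fin 2) ℂ)) := by
  haveI := isProbabilityMeasure_coneMeasure
  exact measurePreserving_pi (fun _ : Fin 3 => coneMeasure) (fun _ : Fin 3 => haarProbability (Matrix.specialUnitaryGroup (Fin 2) ℂ))
    fun _ => measurePreserving_quatToSU2

/-- ★ **THE THREE-LETTER FLOOR (no logarithm).**  There are `c > 0` and `t₀ > 0` (here `c = (2/π²)³/169869312`, `t₀ = 3/32`) such that for
`0 < t ≤ t₀` the product Haar measure of the triples `(C_μ) ∈ SU(2)³` whose unit quaternions pairwise commute up to `t` is at least `c·t⁴`: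
ONE shell (`x 0` at height `ρ = 1/16`, `x 1, x 2` in the rotated thin box of width `δ = 2t/3`, `24ρδ = t`) of mass `coneConst³·ρ⁵δ⁴/32`.
The swap-central zero-mode block of the σ-glued femto ring (cone of commuting triples, pole `2`, multiplicity `1`). [folklore] -/
theorem haar_pi_nearlyCommuting_three_ge :
    ∃ c : ℝ, 0 < c ∧ ∃ t₀ : ℝ, 0 < t₀ ∧ ∀ t : ℝ, 0 < t → t ≤ t₀ →
      c * t ^ 4 ≤
        (Measure.pi fun _ : Fin 3 => haarProbability (Matrix.specialUnitaryGroup (Fin 2) ℂ)).real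
          {C : Fin 3 → (Matrix.specialUnitaryGroup (Fin 2) ℂ) | ∀ μ ν : Fin 3, ‖su2Quat (C μ) * su2Quat (C ν) - su2Quat (C ν) * su2Quat (C μ)‖ ≤ t} := by
  refine ⟨coneConst ^ 3 / 169869312, by have := coneConst_pos; positivity, 3 / 32, by norm_num, fun t ht ht₀ => ?_⟩
  haveI := isProbabilityMeasure_coneMeasure
  -- the shell parameters
  set ρ : ℝ := 1 / 16 with hρdef
  set δ : ℝ := 2 * t / 3 with hδdef
  have hρ0 : 0 < ρ := by norm_num [hρdef]
  have hρ : ρ ≤ 1 / 16 := le_rfl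
  have hδ : 0 ≤ δ := by rw [hδdef]; positivity
  have hδρ : δ ≤ ρ := by rw [hδdef, hρdef]; linarith
  have hcomm : 24 * ρ * δ = t := by rw [hδdef, hρdef]; ring
  -- the event and the shell
  set N : Set (Fin 3 → (Matrix.specialUnitaryGroup (Fin 2) ℂ)) :=
    {C | ∀ μ ν : Fin 3, ‖su2Quat (C μ) * su2Quat (C ν) - su2Quat (C ν) * su2Quat (C μ)‖ ≤ t} with hN
  set S : Set (Fin 3 → ℍ) :=
    {x | x 0 ∈ quatBox (axisLo ρ) (axisHi ρ) ∧ ∀ j : Fin 2, x j.succ ∈ fiber (thinLo ρ δ) (thinHi ρ δ) (x 0)} with hS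
  have hSN : S ⊆ (fun (x : Fin 3 → ℍ) (μ : Fin 3) => quatToSU2 (x μ)) ⁻¹' N := by
    intro x hx
    have h := (three_subset hρ0 hρ hδ hδρ hx.1 hx.2).2
    simp only [hN, Set.mem_preimage, Set.mem_setOf_eq]
    intro μ ν
    rw [← hcomm]
    exact h μ ν
  have hE := measurableSet_nearlyCommuting_three t
  have hmain : ENNReal.ofReal (coneConst ^ 3 * (ρ ^ 5 * δ ^ 4 / 32)) ≤
      (Measure.pi fun _ : Fin 3 => haarProbability (Matrix.specialUnitaryGroup (Fin 2) ℂ)) N := by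
    rw [← pi_coneMeasure_threeShell hρ0 hρ hδ hδρ, ← measurePreserving_proj_three.measure_preimage hE.nullMeasurableSet]
    exact measure_mono hSN
  -- pass to real numbers
  have hfin : (Measure.pi fun _ : Fin 3 => haarProbability (Matrix.specialUnitaryGroup (Fin 2) ℂ)) N ≠ ∞ := measure_ne_top _ _
  have hv : 0 ≤ coneConst ^ 3 * (ρ ^ 5 * δ ^ 4 / 32) := by have := coneConst_pos; positivity
  have hreal : coneConst ^ 3 * (ρ ^ 5 * δ ^ 4 / 32) ≤
      ((Measure.pi fun _ : Fin 3 => haarProbability (Matrix.specialUnitaryGroup (Fin 2) ℂ)) N).toReal := by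
    rw [← ENNReal.ofReal_le_iff_le_toReal hfin]
    exact hmain
  show _ ≤ ((Measure.pi fun _ : Fin 3 => haarProbability (Matrix.specialUnitaryGroup (Fin 2) ℂ)) N).toReal
  refine le_trans (le_of_eq ?_) hreal
  rw [hρdef, hδdef]
  ring

end Summit.QuantumFields.YangMills.Theorems.SwapVirialDeficit.NearlyCommutingThreeFloor

end
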